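import Summits.AtomisticToContinuum.HydrodynamicLimit.Theorems.OneFlightGossipEngineEnergyCurrentTailsRateFloorQuarticRung0
import Summits.AtomisticToContinuum.HydrodynamicLimit.Theorems.OneFlightGossipEngineEnergyCurrentTailsSplitDeficitRung0
import HarnessLib

/-!
# Crux `EnergyCurrentTails` (stmt-AtomisticToContinuum-9235), line `quartic-schur-ledger`:
# rung-0 certificate of the quartic mixing floor QMF (`stub_quarticMixingFloorRung0`)

Stub worker file for the registered audit stub `stub_quarticMixingFloorRung0` of the line lead's
skeleton `Cruxes/EnergyCurrentTails/Lines/quartic_schur_ledger.lean` (primary crux decl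
`Summit.AtomisticToContinuum.HydrodynamicLimit.Theses.WarmColdDichotomy.EnergyCurrentTails`).

**Statement.**  At GLOBAL EQUILIBRIUM with drift (`G_N = localGibbsLaw σ a u θ̄ N (Φ N)`, constant
profiles `a, θ̄ > 0`, drift `u`), for `0 < σ < σ₀` and every flow family there are `N`-independent
`K₀ ≥ 0`, `c > 0` and `N₀` with, for all `N ≥ N₀` and ALL windows `0 ≤ s ≤ t`,
`ofReal(c σ²(N+1)^{1/3}) ∫_{(s,t]} E_G[(N+1)⁻¹ Σᵢ 𝟙{K₀ < ‖vᵢ(τ)‖} ‖vᵢ(τ)‖⁵] dτ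
   ≤ E_G[Σ_{collisions in (s,t]} Σ_{ordered contact pairs (i,j)} 𝟙{K₀ < ‖vᵢ⁻‖} (N+1)⁻¹ 2‖vᵢ⁺‖²‖vⱼ⁺‖²]`
(the quartic mixing floor QMF `stub_quarticMixingFloor` at constant profiles, without horizon).

**Proof** (recombination of the landed rung-0 certificates RF₂ `stub_fastCollisionRateQuarticRung0` and
SD `c5sd_core`).  LEFT `= ofReal(c κ_N) · m · (t − s)`, `m ≤ E‖w‖⁵ < ∞` (invariance and one-body marginal,
`avgMoment_flow_localGibbsLaw_drift`).  RIGHT: `K₀ = √E` at the level `E = max(E_th, 1)` of seat c2's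
landed splitting floor `stub_splitFloorRung0`.  ONE COLLISION (`c5qmf_guard_pair_le`): on the splitting
event of level `E` the faster INCOMING participant is above `√E`, so one of the two ordered contact pairs
carries `𝟙{√E < ‖vᵢ⁻‖}` (`ofConfig_preVel_eq_collidePair`, `collidePair_comm`), while by
`c5sd_splitIndicator_le` either the (symmetric) pair energy lies in the THIN SHELL `(E, (1+η)E)` or
`2‖vᵢ⁺‖²‖vⱼ⁺‖² ≥ 2ηE²`; in expectation (`c5qmf_eventCount_le`)
`eventCount(splitEvent E) ≤ E[CPS(𝟙_thin)] + (N+1)/(ηE²) · RIGHT`.  The thin count is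
`≤ 16(t−s)(N+1)²ε² Θ(η)` (flux ceiling `c5sd_lintegral_collisionPairSum_le`, p98294; `Θ(η) → 0`,
`c5sd_tendsto_thinFlux`), the floor gives `eventCount ≥ ofReal(c₂ κ_N √E (t−s)) (N+1) γ_shell`
(`stub_splitFloorRung0`, `shellCensus_const`); with `32 Θ(η) < c₂ √E γ_shell`,
`RIGHT ≥ ofReal(κ₀ κ_N (t−s))`, `κ₀ = c₂ √E γ_shell ηE²/2`, and `c := κ₀/(E‖w‖⁵ + 1)`, `N₀ := max N₃ 1`.

References: Cercignani–Illner–Pulvirenti 1994 §2.2, §4.2, App. 4.A; Gallagher–Saint-Raymond–Texier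
2013, Prop. 4.1.1; Ruelle 1969 §4.2.
-/

noncomputable section

open MeasureTheory Set Filter Topology
open scoped ENNReal InnerProductSpace

namespace Summit.AtomisticToContinuum.HydrodynamicLimit.Theorems.QuarticSchurLedger

open Literature.MathematicalPhysics.KineticTheory Literature.Analysis.FluidPDE
open Literature.Analysis.FunctionSpaces
open Summit.AtomisticToContinuum.HydrodynamicLimit.Theorems.EnergyCurrentTailsLevelCensus

/-! ### One collision: the guarded splitting indicator versus thin shell and fast product mark -/

/-- **One collision with first label smaller.**  On `𝕋³` with `ε < 1/2`, if `(a, b)` with `a < b` is an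
ordered contact pair of `y`, then over the two orientations `{(a,b), (b,a)}`, for `E, η > 0`:
`Σ_p [p.1 < p.2] 𝟙_{splitEvent E}(record p) ≤ Σ_p 𝟙_thin(v_{p.1}⁺, v_{p.2}⁺)
   + ofReal((N+1)/(ηE²)) · Σ_p 𝟙{√E < ‖v_{p.1}⁻‖} ofReal((N+1)⁻¹ 2‖v_{p.1}⁺‖²‖v_{p.2}⁺‖²)`
— a splitting collision has `E < max(‖v_a⁻‖², ‖v_b⁻‖²)` (`ofConfig_preVel_eq_collidePair`,
`collidePair_comm` at contact), and `c5sd_splitIndicator_le` (thin shell or large product, both symmetric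
in the pair). [folklore] -/
theorem c5qmf_guard_pair_le {N : ℕ} {ε : ℝ} (hε2 : ε < 2⁻¹) {y : Config (N + 1) (Fin 3) T3}
    {a b : Fin (N + 1)} (hlt : a < b) (hab : (a, b) ∈ contactPairs (Torus.geometry (Fin 3)) ε y)
    {E η : ℝ} (hE : 0 < E) (hη : 0 < η) (t : ℝ) :
    (∑ p ∈ ({(a, b), (b, a)} : Finset (Fin (N + 1) × Fin (N + 1))),
        (if p.1 < p.2 then (splitEvent E).indicator (fun _ => (1 : ℝ≥0∞))
          ((HardSphereCollisionRecord.ofConfig (Torus.geometry (Fin 3)) ε y t p.1 p.2).preVel,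
            (HardSphereCollisionRecord.ofConfig (Torus.geometry (Fin 3)) ε y t p.1 p.2).postVel) else 0)) ≤
      (∑ p ∈ ({(a, b), (b, a)} : Finset (Fin (N + 1) × Fin (N + 1))),
          {q : V3 × V3 | E < ‖q.1‖ ^ 2 + ‖q.2‖ ^ 2 ∧ ‖q.1‖ ^ 2 + ‖q.2‖ ^ 2 < (1 + η) * E}.indicator
            (fun _ => (1 : ℝ≥0∞)) ((y p.1).2, (y p.2).2)) +
        ENNReal.ofReal (((N + 1 : ℕ) : ℝ) / (η * E ^ 2)) *
          ∑ p ∈ ({(a, b), (b, a)} : Finset (Fin (N + 1) × Fin (N + 1))),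
            (if Real.sqrt E < ‖(collidePair (Torus.geometry (Fin 3)) p.1 p.2 y p.1).2‖ then
              ENNReal.ofReal (((N + 1 : ℕ) : ℝ)⁻¹ * (2 * (‖(y p.1).2‖ ^ 2 * ‖(y p.2).2‖ ^ 2))) else 0) := by
  have hG : (Torus.geometry (Fin 3)).IsHardSphereRegular ε := Torus.isHardSphereRegular_geometry hε2
  have hne : a ≠ b := hlt.ne
  have hne2 : ((a, b) : Fin (N + 1) × Fin (N + 1)) ≠ (b, a) := fun h => hne (Prod.mk.inj h).1
  obtain ⟨-, hc⟩ := mem_contactPairs.1 hab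
  have hsep : ‖(Torus.geometry (Fin 3)).sepVec (y a).1 (y b).1‖ = ε := (mem_contactSet.1 hc).2
  have hN : ((N + 1 : ℕ) : ℝ) ≠ 0 := by positivity
  rw [Finset.sum_pair hne2, Finset.sum_pair hne2, Finset.sum_pair hne2, if_pos hlt,
    if_neg (not_lt.2 hlt.le), add_zero]
  simp only [HardSphereCollisionRecord.ofConfig_postVel]
  have hpre : (HardSphereCollisionRecord.ofConfig (Torus.geometry (Fin 3)) ε y t a b).preVel =
      ((collidePair (Torus.geometry (Fin 3)) a b y a).2, (collidePair (Torus.geometry (Fin 3)) a b y b).2) :=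
    HardSphereCollisionRecord.ofConfig_preVel_eq_collidePair _ ε y t hne
  have hcomm : collidePair (Torus.geometry (Fin 3)) b a y = collidePair (Torus.geometry (Fin 3)) a b y :=
    hG.collidePair_comm hne hsep.le
  have hsqrt : ∀ w : V3, E < ‖w‖ ^ 2 → Real.sqrt E < ‖w‖ := fun w hw => by
    have h := Real.sqrt_lt_sqrt hE.le hw
    rwa [Real.sqrt_sq (norm_nonneg _)] at h
  have hC : ∀ v w : V3, ENNReal.ofReal (((N + 1 : ℕ) : ℝ) / (η * E ^ 2)) *
      ENNReal.ofReal (((N + 1 : ℕ) : ℝ)⁻¹ * (2 * (‖v‖ ^ 2 * ‖w‖ ^ 2))) =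
      ENNReal.ofReal ((η * E ^ 2)⁻¹ * (2 * (‖v‖ ^ 2 * ‖w‖ ^ 2))) := by
    intro v w
    rw [← ENNReal.ofReal_mul (by positivity)]
    congr 1
    field_simp
  by_cases hm : ((HardSphereCollisionRecord.ofConfig (Torus.geometry (Fin 3)) ε y t a b).preVel,
      ((y a).2, (y b).2)) ∈ splitEvent E
  · rw [Set.indicator_of_mem hm]
    have hone : (1 : ℝ≥0∞) ≤
        {q : V3 × V3 | E < ‖q.1‖ ^ 2 + ‖q.2‖ ^ 2 ∧ ‖q.1‖ ^ 2 + ‖q.2‖ ^ 2 < (1 + η) * E}.indicator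
            (fun _ => (1 : ℝ≥0∞)) ((y a).2, (y b).2) +
          ENNReal.ofReal ((η * E ^ 2)⁻¹ * (2 * (‖(y a).2‖ ^ 2 * ‖(y b).2‖ ^ 2))) := by
      have h := c5sd_splitIndicator_le hE hη
        (HardSphereCollisionRecord.ofConfig (Torus.geometry (Fin 3)) ε y t a b).preVel ((y a).2, (y b).2)
        (HardSphereCollisionRecord.ofConfig_norm_sq_preVel _ _ _ _ _ _)
      rwa [Set.indicator_of_mem hm] at h
    have hmax : E < max (‖(collidePair (Torus.geometry (Fin 3)) a b y a).2‖ ^ 2)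
        (‖(collidePair (Torus.geometry (Fin 3)) a b y b).2‖ ^ 2) := by
      simpa only [maxPre, hpre] using hm.1
    rcases lt_max_iff.1 hmax with h1 | h2
    · rw [if_pos (hsqrt _ h1)]; rw [← hC (y a).2 (y b).2] at hone
      exact hone.trans (add_le_add le_self_add (mul_le_mul_right le_self_add _))
    · rw [hcomm, if_pos (hsqrt _ h2)]
      rw [mul_comm (‖(y a).2‖ ^ 2) (‖(y b).2‖ ^ 2), ← hC (y b).2 (y a).2] at hone
      exact hone.trans (add_le_add le_self_add (mul_le_mul_right le_add_self _))
  · rw [Set.indicator_of_notMem hm]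
    exact zero_le

section Flow

variable {σ : ℝ} {N : ℕ}

/-- **Pathwise comparison on the good set.**  For `0 < σ < 1/2`, a flow `Φ`, a good datum `z`,
`E, η > 0` and a window `(s, t]`:
`eventSum Φ s t (splitEvent E) z ≤ CPS_{(s,t]}(𝟙_thin(vᵢ⁺,vⱼ⁺)) + ofReal((N+1)/(ηE²)) ·
  CPS_{(s,t]}(𝟙{√E < ‖vᵢ⁻‖} ofReal((N+1)⁻¹ 2‖vᵢ⁺‖²‖vⱼ⁺‖²))` — collision by collision (`contactPairs_eq_pair`,
`c5qmf_guard_pair_le`). [folklore] -/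
theorem c5qmf_eventSum_le (hσ : 0 < σ) (hσ2 : σ < 1 / 2) (Φ : Flow σ N)
    {z : Config (N + 1) (Fin 3) T3} (hz : z ∈ Φ.good) {E η : ℝ} (hE : 0 < E) (hη : 0 < η) (s t : ℝ) :
    eventSum Φ s t (splitEvent E) z ≤
      Φ.collisionPairSum (Ioc s t) (fun _ w i j =>
          {p : V3 × V3 | E < ‖p.1‖ ^ 2 + ‖p.2‖ ^ 2 ∧ ‖p.1‖ ^ 2 + ‖p.2‖ ^ 2 < (1 + η) * E}.indicator
            (fun _ => (1 : ℝ≥0∞)) ((w i).2, (w j).2)) z +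
        ENNReal.ofReal (((N + 1 : ℕ) : ℝ) / (η * E ^ 2)) *
          Φ.collisionPairSum (Ioc s t) (fun _ w i j =>
            if Real.sqrt E < ‖(collidePair (Torus.geometry (Fin 3)) i j w i).2‖ then
              ENNReal.ofReal (((N + 1 : ℕ) : ℝ)⁻¹ * (2 * (‖(w i).2‖ ^ 2 * ‖(w j).2‖ ^ 2))) else 0) z := by
  have hε2 : hsDiameter σ N < 2⁻¹ := (hsDiameter_le hσ.le N).trans_lt (by norm_num at hσ2 ⊢; linarith)
  have hG : (Torus.geometry (Fin 3)).IsHardSphereRegular (hsDiameter σ N) :=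
    Torus.isHardSphereRegular_geometry hε2
  have htraj := Φ.isTrajectory z hz
  have hfin := Φ.finite_collisionTimes_inter hz (Ioc_subset_Icc_self : Ioc s t ⊆ Icc s t)
  simp only [eventSum, HardSphereFlow.collisionSum_eq, HardSphereFlow.collisionPairSum,
    Literature.Analysis.FluidPDE.collisionSum_eq_collisionPairSum]
  rw [collisionPairSum_eq_finset_sum hfin, collisionPairSum_eq_finset_sum hfin,
    collisionPairSum_eq_finset_sum hfin, Finset.mul_sum, ← Finset.sum_add_distrib]
  refine Finset.sum_le_sum fun τ hτ => ?_
  simp only [HardSphereCollisionRecord.ofConfig_fst, HardSphereCollisionRecord.ofConfig_snd]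
  have hτ' : τ ∈ collisionTimes (Torus.geometry (Fin 3)) (hsDiameter σ N) (fun r => Φ.flow r z) :=
    ((Set.Finite.mem_toFinset hfin).1 hτ).1
  obtain ⟨⟨a, b⟩, hab⟩ := mem_collisionTimes_iff_contactPairs_nonempty.1 hτ'
  rcases lt_or_gt_of_ne (mem_contactPairs.1 hab).1 with hlt | hgt
  · rw [htraj.contactPairs_eq_pair hG hab]
    exact c5qmf_guard_pair_le hε2 hlt hab hE hη τ
  · have hba : ((b, a) : Fin (N + 1) × Fin (N + 1)) ∈
        contactPairs (Torus.geometry (Fin 3)) (hsDiameter σ N) (Φ.flow τ z) :=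
      (swap_mem_contactPairs_iff hG (p := (a, b))).2 hab
    rw [htraj.contactPairs_eq_pair hG hba]
    exact c5qmf_guard_pair_le hε2 hgt hba hE hη τ

/-- **Expected comparison.**  For `0 < σ < 1/2`, every local Gibbs law, every flow, `E, η > 0` and every
window: `eventCount (s,t] (splitEvent E) ≤ E[CPS(𝟙_thin(vᵢ⁺,vⱼ⁺))] + (N+1)/(ηE²) ·
E[CPS(𝟙{√E < ‖vᵢ⁻‖}(N+1)⁻¹ 2‖vᵢ⁺‖²‖vⱼ⁺‖²)]` (`c5qmf_eventSum_le` a.e. on the conull good set; the thin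
count is a.e.-measurable, `c5sd_aemeasurable_collisionPairSum`). [folklore] -/
theorem c5qmf_eventCount_le (hσ : 0 < σ) (hσ2 : σ < 1 / 2) (a₀ θ₀ : T3 → ℝ) (u₀ : T3 → V3)
    (Φ : Flow σ N) {E η : ℝ} (hE : 0 < E) (hη : 0 < η) (s t : ℝ) :
    eventCount σ a₀ θ₀ u₀ N Φ s t (splitEvent E) ≤
      (∫⁻ z, Φ.collisionPairSum (Ioc s t) (fun _ w i j =>
          {p : V3 × V3 | E < ‖p.1‖ ^ 2 + ‖p.2‖ ^ 2 ∧ ‖p.1‖ ^ 2 + ‖p.2‖ ^ 2 < (1 + η) * E}.indicator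
            (fun _ => (1 : ℝ≥0∞)) ((w i).2, (w j).2)) z ∂(localGibbsLaw σ a₀ u₀ θ₀ N Φ)) +
        ENNReal.ofReal (((N + 1 : ℕ) : ℝ) / (η * E ^ 2)) *
          ∫⁻ z, Φ.collisionPairSum (Ioc s t) (fun _ w i j =>
            if Real.sqrt E < ‖(collidePair (Torus.geometry (Fin 3)) i j w i).2‖ then
              ENNReal.ofReal (((N + 1 : ℕ) : ℝ)⁻¹ * (2 * (‖(w i).2‖ ^ 2 * ‖(w j).2‖ ^ 2))) else 0) z
            ∂(localGibbsLaw σ a₀ u₀ θ₀ N Φ) := by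
  have hgm : ∀ i j : Fin (N + 1), Measurable fun w : Config (N + 1) (Fin 3) T3 =>
      {p : V3 × V3 | E < ‖p.1‖ ^ 2 + ‖p.2‖ ^ 2 ∧ ‖p.1‖ ^ 2 + ‖p.2‖ ^ 2 < (1 + η) * E}.indicator
        (fun _ => (1 : ℝ≥0∞)) ((w i).2, (w j).2) :=
    fun i j => (measurable_const.indicator (c5sd_measurableSet_thin E _)).comp
      ((measurable_pi_apply i).snd.prodMk (measurable_pi_apply j).snd)
  have hmeas := c5sd_aemeasurable_collisionPairSum hσ hσ2 a₀ θ₀ u₀ Φ (fun w i j =>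
      {p : V3 × V3 | E < ‖p.1‖ ^ 2 + ‖p.2‖ ^ 2 ∧ ‖p.1‖ ^ 2 + ‖p.2‖ ^ 2 < (1 + η) * E}.indicator
        (fun _ => (1 : ℝ≥0∞)) ((w i).2, (w j).2)) hgm s t
  unfold eventCount
  refine (lintegral_mono_ae ((ae_mem_good_localGibbsLaw σ a₀ u₀ θ₀ N Φ).mono fun z hz =>
    c5qmf_eventSum_le hσ hσ2 Φ hz hE hη s t)).trans (le_of_eq ?_)
  rw [lintegral_add_left' hmeas, lintegral_const_mul' _ _ ENNReal.ofReal_ne_top]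

end Flow

/-! ### The certificate -/

/-- **Audit stub `stub_quarticMixingFloorRung0` — QMF at rung 0 (global equilibrium with drift),
uniformly in `N ≥ N₀` and in the window.**  For constant profiles `a, θ̄ > 0`, drift `u`, there is
`σ₀ > 0` such that for `0 < σ < σ₀` and every flow family there are `K₀ ≥ 0`, `c > 0`, `N₀` with, for all
`N ≥ N₀` and `0 ≤ s ≤ t`,
`ofReal(c σ²(N+1)^{1/3}) ∫_{(s,t]} E_G[(N+1)⁻¹Σᵢ 𝟙{K₀<‖vᵢ(τ)‖}‖vᵢ(τ)‖⁵] dτ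
   ≤ E_G[Σ_{coll ∈ (s,t]} Σ_{(i,j)} 𝟙{K₀<‖vᵢ⁻‖}(N+1)⁻¹ 2‖vᵢ⁺‖²‖vⱼ⁺‖²]`.
Proof: LEFT `= ofReal(c κ_N) · E_{N(u,θ̄)}[𝟙{K₀<‖w‖}‖w‖⁵] · (t−s) ≤ … E‖w‖⁵` (stationarity and one-body
marginal, `avgMoment_flow_localGibbsLaw_drift`); RIGHT: with `K₀ = √E`, `E = max(E_th, 1)`,
`eventCount(splitEvent E) ≤ Thin + ofReal((N+1)/(ηE²)) · RIGHT` (`c5qmf_eventCount_le`), the thin count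
`≤ ofReal(X/2)` by the flux ceiling and the choice of `η` (`c5sd_lintegral_collisionPairSum_le`,
`c5sd_tendsto_thinFlux`), the floor `ofReal X ≤ eventCount` (`stub_splitFloorRung0`, `shellCensus_const`),
`X = c₂ √E γ_shell (N+1)² ε² (t−s)`; whence `RIGHT ≥ ofReal(κ₀ (N+1)ε²(t−s))` and
`c := κ₀/(E‖w‖⁵ + 1)`, read on the routes' inline form (`c5sd_finsum_eq_collisionPairSum`). [folklore] -/
theorem stub_quarticMixingFloorRung0 :
    ∀ (a θb : ℝ) (u : V3), 0 < a → 0 < θb →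
      ∃ σ₀ : ℝ, 0 < σ₀ ∧ ∀ σ : ℝ, 0 < σ → σ < σ₀ →
        ∀ Φ : ((N : ℕ) → HardSphereFlow (Torus.geometry (Fin 3)) (hsDiameter σ N) (N + 1)),
          ∃ K₀ : ℝ, 0 ≤ K₀ ∧ ∃ c : ℝ, 0 < c ∧ ∃ N₀ : ℕ, ∀ N : ℕ, N₀ ≤ N →
            ∀ s t : ℝ, 0 ≤ s → s ≤ t →
              ENNReal.ofReal (c * (σ ^ 2 * ((N + 1 : ℕ) : ℝ) ^ ((1 : ℝ) / 3))) *
                  ∫⁻ τ in Set.Ioc s t, (∫⁻ z, ENNReal.ofReal (((N + 1 : ℕ) : ℝ)⁻¹ *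
                    ∑ i : Fin (N + 1), if K₀ < ‖(((Φ N).flow τ z) i).2‖ then
                      ‖(((Φ N).flow τ z) i).2‖ ^ 5 else 0) ∂(localGibbsLaw σ (fun _ => a) (fun _ => u) (fun _ => θb) N (Φ N))) ≤
                ∫⁻ z, (∑ᶠ τ ∈ collisionTimes (Torus.geometry (Fin 3)) (hsDiameter σ N)
                    (fun r => (Φ N).flow r z) ∩ Set.Ioc s t,
                  ∑ i : Fin (N + 1), ∑ j : Fin (N + 1), if i = j then (0 : ℝ≥0∞) else
                    (contactSet (Torus.geometry (Fin 3)) (N + 1) (hsDiameter σ N) i j).indicator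
                      (fun y => if K₀ < ‖((collidePair (Torus.geometry (Fin 3)) i j y) i).2‖ then
                        ENNReal.ofReal (((N + 1 : ℕ) : ℝ)⁻¹ *
                          (2 * (‖(y i).2‖ ^ 2 * ‖(y j).2‖ ^ 2))) else 0)
                      ((Φ N).flow τ z)) ∂(localGibbsLaw σ (fun _ => a) (fun _ => u) (fun _ => θb) N (Φ N)) := by
  intro a θb u ha hθ
  obtain ⟨σA, hσA, hsmallA⟩ := exists_smallDensity uniformProfile one_pos
  obtain ⟨σB, hσB, hfloorB⟩ := stub_splitFloorRung0 a θb u ha hθ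
  refine ⟨min σA σB, lt_min hσA hσB, fun σ hσ hσlt Φ => ?_⟩
  have hsm : SmallDensity uniformProfile σ := (hsmallA σ hσ (hσlt.trans_le (min_le_left _ _))).1
  have hσ2 : σ < 1 / 2 := hsm.σ_lt_half
  obtain ⟨cs, hcs, Eth, N₃, hfloor⟩ := hfloorB σ hσ (hσlt.trans_le (min_le_right _ _)) Φ
  -- the level `E` (threshold `K₀ = √E`) and the Gaussian constants
  set E : ℝ := max Eth 1 with hEdef
  have hE : 0 < E := lt_of_lt_of_le one_pos (le_max_right _ _)
  have hEth : Eth ≤ E := le_max_left _ _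
  set γS : ℝ≥0∞ := gaussMeasure u θb {v : V3 | E < ‖v‖ ^ 2 ∧ ‖v‖ ^ 2 ≤ 3 / 2 * E} with hγSdef
  have hγS0 : γS ≠ 0 := c5sd_gaussMeasure_shell_ne_zero u hθ hE
  have hγStop : γS ≠ ⊤ := measure_ne_top _ _
  set gS : ℝ := γS.toReal with hgSdef
  have hgS : 0 < gS := ENNReal.toReal_pos hγS0 hγStop
  have hγSeq : γS = ENNReal.ofReal gS := (ENNReal.ofReal_toReal hγStop).symm
  set m₅ : ℝ≥0∞ := ∫⁻ w, ENNReal.ofReal (‖w‖ ^ 5) ∂(gaussMeasure u θb) with hm₅def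
  have hm₅top : m₅ ≠ ⊤ := lintegral_norm_pow_gaussMeasure_ne_top u θb (k := 5) (by norm_num)
  set m₅r : ℝ := m₅.toReal with hm₅rdef
  have hm₅r : 0 ≤ m₅r := ENNReal.toReal_nonneg
  have hm₅eq : m₅ = ENNReal.ofReal m₅r := (ENNReal.ofReal_toReal hm₅top).symm
  -- the thin shell: `η = 1/(n+1)` with `Θ(η) < cs √E gS / 32`
  have hlim := c5sd_tendsto_thinFlux u θb hE
  have htarget : (0 : ℝ≥0∞) < ENNReal.ofReal (cs * Real.sqrt E * gS / 32) :=
    ENNReal.ofReal_pos.2 (by positivity)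
  obtain ⟨n, hn⟩ := ((tendsto_order.1 hlim).2 _ htarget).exists
  set η : ℝ := 1 / ((n : ℝ) + 1) with hηdef
  have hη : 0 < η := by positivity
  -- the constants
  set κ₀ : ℝ := cs * Real.sqrt E * gS * (η * E ^ 2) / 2 with hκ₀def
  have hκ₀ : 0 < κ₀ := by positivity
  set c : ℝ := κ₀ / (m₅r + 1) with hcdef
  have hc : 0 < c := by positivity
  refine ⟨Real.sqrt E, Real.sqrt_nonneg E, c, hc, max N₃ 1, fun N hN s t hs hst => ?_⟩
  have hN₃ : N₃ ≤ N := le_of_max_le_left hN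
  have hN1 : 1 ≤ N := le_of_max_le_right hN
  rcases hst.eq_or_lt with heq | hlt
  · subst heq
    rw [Set.Ioc_self, setLIntegral_empty, mul_zero]
    exact zero_le
  -- abbreviations
  set τ : ℝ := t - s with hτdef
  have hτ : 0 < τ := sub_pos.2 hlt
  set ε : ℝ := hsDiameter σ N with hεdef
  have hε : 0 < ε := hsDiameter_pos hσ N
  set P := localGibbsLaw σ (fun _ => a) (fun _ => u) (fun _ => θb) N (Φ N) with hPdef
  have hgood := ae_mem_good_localGibbsLaw σ (fun _ => a) (fun _ => u) (fun _ => θb) N (Φ N)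
  set R : ℝ≥0∞ := ∫⁻ z, (Φ N).collisionPairSum (Ioc s t) (fun _ w i j =>
      if Real.sqrt E < ‖(collidePair (Torus.geometry (Fin 3)) i j w i).2‖ then
        ENNReal.ofReal (((N + 1 : ℕ) : ℝ)⁻¹ * (2 * (‖(w i).2‖ ^ 2 * ‖(w j).2‖ ^ 2))) else 0) z ∂P
    with hRdef
  set Y : ℝ := ((N + 1 : ℕ) : ℝ) * ε ^ 2 * τ with hYdef
  have hY : 0 ≤ Y := by positivity
  set X : ℝ := cs * Real.sqrt E * gS * ((N + 1 : ℕ) : ℝ) * Y with hXdef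
  have hX : 0 ≤ X := by positivity
  have hNr : ((N + 1 : ℕ) : ℝ) ≠ 0 := by positivity
  have hcast : ((N + 1 : ℕ) : ℝ) = (N : ℝ) + 1 := by push_cast; ring
  -- (T) the flux ceiling of the thin shell
  have hATm : Measurable ({p : V3 × V3 | E < ‖p.1‖ ^ 2 + ‖p.2‖ ^ 2 ∧
      ‖p.1‖ ^ 2 + ‖p.2‖ ^ 2 < (1 + η) * E}.indicator fun _ => (1 : ℝ≥0∞)) :=
    measurable_const.indicator (c5sd_measurableSet_thin E _)
  have hT := c5sd_lintegral_collisionPairSum_le hσ hsm ha hθ u hN1 (Φ N) hATm hlt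
  have hTX : (∫⁻ z, (Φ N).collisionPairSum (Ioc s t) (fun _ w i j =>
      {p : V3 × V3 | E < ‖p.1‖ ^ 2 + ‖p.2‖ ^ 2 ∧ ‖p.1‖ ^ 2 + ‖p.2‖ ^ 2 < (1 + η) * E}.indicator
        (fun _ => (1 : ℝ≥0∞)) ((w i).2, (w j).2)) z ∂P) ≤ ENNReal.ofReal (X / 2) := by
    refine hT.trans ((mul_le_mul_right hn.le _).trans_eq ?_)
    rw [← ENNReal.ofReal_mul (by positivity)]
    congr 1
    rw [hXdef, hYdef]
    ring
  -- (S) the splitting floor and the census at rung 0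
  have hS := hfloor N hN₃ s t hs hst E hEth
  rw [← succ_mul_hsDiameter_sq_eq_clock] at hS
  have hcensus : ((N + 1 : ℕ) : ℝ≥0∞) * γS ≤ ⨅ r ∈ Icc s t,
      shellCensus σ (fun _ => a) (fun _ => θb) (fun _ => u) N (Φ N) r E (3 / 2 * E) :=
    le_iInf₂ fun r _ => (shellCensus_const hσ2.le ha hθ u N (Φ N) r E (3 / 2 * E)).ge
  have hSX : ENNReal.ofReal X ≤
      eventCount σ (fun _ => a) (fun _ => θb) (fun _ => u) N (Φ N) s t (splitEvent E) := by
    calc ENNReal.ofReal X = ENNReal.ofReal (cs * (((N + 1 : ℕ) : ℝ) * ε ^ 2) * Real.sqrt E * τ) *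
          (((N + 1 : ℕ) : ℝ≥0∞) * γS) := by
          rw [hγSeq, ← ENNReal.ofReal_natCast, ← ENNReal.ofReal_mul (Nat.cast_nonneg _),
            ← ENNReal.ofReal_mul (by positivity)]
          congr 1
          rw [hXdef, hYdef]
          ring
      _ ≤ ENNReal.ofReal (cs * (((N + 1 : ℕ) : ℝ) * ε ^ 2) * Real.sqrt E * τ) *
          ⨅ r ∈ Icc s t, shellCensus σ (fun _ => a) (fun _ => θb) (fun _ => u) N (Φ N) r E (3 / 2 * E) :=
          mul_le_mul_right hcensus _
      _ ≤ _ := hS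
  -- (E) the pathwise comparison in expectation: `ofReal X ≤ ofReal (X/2) + C R`
  have hEv := c5qmf_eventCount_le hσ hσ2 (fun _ => a) (fun _ => θb) (fun _ => u) (Φ N) hE hη s t
  set C : ℝ≥0∞ := ENNReal.ofReal (((N + 1 : ℕ) : ℝ) / (η * E ^ 2)) with hCdef
  have hX2 : ENNReal.ofReal (X / 2) ≤ C * R := by
    have h1 : ENNReal.ofReal X ≤ ENNReal.ofReal (X / 2) + C * R :=
      hSX.trans (hEv.trans (add_le_add_left hTX _))
    have hsplit : ENNReal.ofReal X = ENNReal.ofReal (X / 2) + ENNReal.ofReal (X / 2) := by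
      rw [← ENNReal.ofReal_add (by positivity) (by positivity), add_halves]
    rw [hsplit] at h1
    exact (ENNReal.add_le_add_iff_left ENNReal.ofReal_ne_top).1 h1
  have hR : ENNReal.ofReal (κ₀ * Y) ≤ R := by
    have hprod : ENNReal.ofReal (η * E ^ 2 / ((N + 1 : ℕ) : ℝ)) * C = 1 := by
      rw [hCdef, ← ENNReal.ofReal_mul (by positivity), ← ENNReal.ofReal_one]
      congr 1
      field_simp
    calc ENNReal.ofReal (κ₀ * Y)
        = ENNReal.ofReal (η * E ^ 2 / ((N + 1 : ℕ) : ℝ)) * ENNReal.ofReal (X / 2) := by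
          rw [← ENNReal.ofReal_mul (by positivity)]
          congr 1
          rw [hκ₀def, hXdef]
          field_simp
      _ ≤ ENNReal.ofReal (η * E ^ 2 / ((N + 1 : ℕ) : ℝ)) * (C * R) := mul_le_mul_right hX2 _
      _ = R := by rw [← mul_assoc, hprod, one_mul]
  -- the right side of the stub is `R`, read on the routes' inline form
  have hRHS : R = ∫⁻ z, (∑ᶠ r ∈ collisionTimes (Torus.geometry (Fin 3)) (hsDiameter σ N)
        (fun r => (Φ N).flow r z) ∩ Set.Ioc s t,
      ∑ i : Fin (N + 1), ∑ j : Fin (N + 1), if i = j then (0 : ℝ≥0∞) else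
        (contactSet (Torus.geometry (Fin 3)) (N + 1) (hsDiameter σ N) i j).indicator
          (fun y => if Real.sqrt E < ‖((collidePair (Torus.geometry (Fin 3)) i j y) i).2‖ then
            ENNReal.ofReal (((N + 1 : ℕ) : ℝ)⁻¹ * (2 * (‖(y i).2‖ ^ 2 * ‖(y j).2‖ ^ 2))) else 0)
          ((Φ N).flow r z)) ∂P := by
    refine lintegral_congr_ae ?_
    filter_upwards [hgood] with z hz
    exact (c5sd_finsum_eq_collisionPairSum (Φ N) hz (Set.Ioc s t) (fun y i j =>
      if Real.sqrt E < ‖((collidePair (Torus.geometry (Fin 3)) i j y) i).2‖ then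
        ENNReal.ofReal (((N + 1 : ℕ) : ℝ)⁻¹ * (2 * (‖(y i).2‖ ^ 2 * ‖(y j).2‖ ^ 2))) else 0)).symm
  -- LEFT: the inner expectation is the constant Gaussian moment `m ≤ m₅`
  have hhm : Measurable fun w : V3 => if Real.sqrt E < ‖w‖ then ‖w‖ ^ 5 else 0 :=
    Measurable.ite (measurableSet_lt measurable_const measurable_norm) (measurable_norm.pow_const 5)
      measurable_const
  have hh0 : ∀ w : V3, 0 ≤ (if Real.sqrt E < ‖w‖ then ‖w‖ ^ 5 else 0) := fun w => by
    split_ifs <;> positivity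
  set m : ℝ≥0∞ := ∫⁻ w, ENNReal.ofReal (if Real.sqrt E < ‖w‖ then ‖w‖ ^ 5 else 0) ∂(gaussMeasure u θb)
    with hmdef
  have hinner : ∀ r : ℝ, (∫⁻ z, ENNReal.ofReal (((N + 1 : ℕ) : ℝ)⁻¹ *
      ∑ i : Fin (N + 1), (if Real.sqrt E < ‖((Φ N).flow r z i).2‖ then ‖((Φ N).flow r z i).2‖ ^ 5
        else 0)) ∂P) = m := by
    intro r
    rw [hcast]
    exact avgMoment_flow_localGibbsLaw_drift hσ2.le ha hθ u N (Φ N) r hhm hh0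
  have hm5 : m ≤ m₅ :=
    lintegral_mono fun w => ENNReal.ofReal_le_ofReal (by split_ifs <;> [exact le_rfl; positivity])
  have hLEFT : (∫⁻ r in Set.Ioc s t, (∫⁻ z, ENNReal.ofReal (((N + 1 : ℕ) : ℝ)⁻¹ *
      ∑ i : Fin (N + 1), (if Real.sqrt E < ‖((Φ N).flow r z i).2‖ then ‖((Φ N).flow r z i).2‖ ^ 5
        else 0)) ∂P)) ≤ m₅ * ENNReal.ofReal τ := by
    calc (∫⁻ r in Set.Ioc s t, (∫⁻ z, ENNReal.ofReal (((N + 1 : ℕ) : ℝ)⁻¹ *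
          ∑ i : Fin (N + 1), (if Real.sqrt E < ‖((Φ N).flow r z i).2‖ then ‖((Φ N).flow r z i).2‖ ^ 5
            else 0)) ∂P))
        = ∫⁻ _r in Set.Ioc s t, m := lintegral_congr fun r => hinner r
      _ = m * volume (Set.Ioc s t) := setLIntegral_const _ _
      _ = m * ENNReal.ofReal τ := by rw [Real.volume_Ioc]
      _ ≤ m₅ * ENNReal.ofReal τ := mul_le_mul' hm5 le_rfl
  -- constants
  have hclock : σ ^ 2 * ((N + 1 : ℕ) : ℝ) ^ ((1 : ℝ) / 3) = ((N + 1 : ℕ) : ℝ) * ε ^ 2 := by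
    rw [hεdef, succ_mul_hsDiameter_sq_eq_clock, clock, hcast]
  have hkey : c * m₅r ≤ κ₀ := by
    rw [hcdef, div_mul_eq_mul_div, div_le_iff₀ (by positivity)]
    exact mul_le_mul_of_nonneg_left (by linarith) hκ₀.le
  have hA0 : 0 ≤ c * (((N + 1 : ℕ) : ℝ) * ε ^ 2) := by positivity
  -- assemble
  calc ENNReal.ofReal (c * (σ ^ 2 * ((N + 1 : ℕ) : ℝ) ^ ((1 : ℝ) / 3))) * _
      ≤ ENNReal.ofReal (c * (σ ^ 2 * ((N + 1 : ℕ) : ℝ) ^ ((1 : ℝ) / 3))) * (m₅ * ENNReal.ofReal τ) :=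
        mul_le_mul' le_rfl hLEFT
    _ = ENNReal.ofReal (c * m₅r * Y) := by
        rw [hclock, hm₅eq, ← ENNReal.ofReal_mul hm₅r, ← ENNReal.ofReal_mul hA0]
        congr 1
        rw [hYdef]
        ring
    _ ≤ ENNReal.ofReal (κ₀ * Y) := ENNReal.ofReal_le_ofReal (mul_le_mul_of_nonneg_right hkey hY)
    _ ≤ R := hR
    _ = _ := hRHS

end Summit.AtomisticToContinuum.HydrodynamicLimit.Theorems.QuarticSchurLedger

end
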